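import Summits.HubbardSuperconductivity.HubbardSuperconductivity.Theorems.LevyLogBootstrapDressHalfFilledInterHopColumns
import Literature.MathematicalPhysics.QuantumLattice.ClusterProductSlice
import Literature.MathematicalPhysics.QuantumLattice.InterClusterKernelIdentification
import HarnessLib

/-!
# Crux `DressHalfFilled` (stmt-HubbardSuperconductivity-8148, routes `AnisotropyChord` / `LevyLogBootstrap`), stub 3
# `stub_dressHalfFilled`: THE FIRST-ORDER SCHRIEFFER–WOLFF TERM VANISHES — `Φᴴ T Φ = 0` for the plaquette dictionary

Helper file (`--supports stmt-HubbardSuperconductivity-8148`). Notation: `Φ = TorusPlaquette.dictionaryMap M U` (the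
dictionary isometry of `PlaquetteDictionary U`, side `L = 2M`; its column at the spin configuration `σ` is the Koszul
product `⊗_R ψ_{σ_R}` of plaquette ground states with `4` (`σ_R = 0`, no hole pair) or `2` (`σ_R = 1`, one hole pair)
electrons), `T = hamiltonian G_inter 1 0` the inter-plaquette hopping of the checkerboard torus.

The open stub asks that the `O(t'²)` XXZ order survive the `O(t'³)` Schrieffer–Wolff remainder. The expansion
`H_L(t', U) = H_in + t' T` starts at SECOND order only because the first-order term vanishes on the unperturbed ground
space: `P T P = 0`, i.e. `Φᴴ T Φ = 0` — a hypothesis of every reduction-process statement in the tree (e.g.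
`Literature/…/StrongCouplingSecondOrderLimit`, Kato 1966 II-§2.3 with `P T⁽¹⁾ P = 0`) that the dictionary clauses
(a)–(e) of `PlaquetteDictionary` do not record. This file proves it:

* `star_plaquetteStates_dotProduct_creation_mulVec`, `…_annihilation_mulVec` — one electron added to / removed from a
  plaquette ground state is orthogonal to both plaquette ground states (particle numbers `5, 3` resp. `3, 1` vs `4, 2`);
* `star_col_dotProduct_hamiltonian_inter_mulVec_col` — **`⟨Φ e_{σ'}, T Φ e_σ⟩ = 0`** for all configurations (`M ≥ 2`):
  `T` applied to a column is a bond sum of two-cluster slices of hop vectors (`hamiltonian_inter_mulVec_col`), the column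
  `σ'` is the slice of its own two factors, slices pair by the Gram identity, and every hop vector has a factor
  `c† ψ` or `c ψ` orthogonal to the plaquette states;
* `star_dictionaryMap_mulVec_dotProduct_hamiltonian_inter` — the sesquilinear form: `⟨Φ φ', T Φ φ⟩ = 0` for all `φ', φ`;
* `dictionaryMap_conjTranspose_mul_hamiltonian_inter_mul` — **`Φᴴ T Φ = 0`** as a matrix identity.

HONEST LABEL: exact finite-dimensional bookkeeping for the line's Schrieffer–Wolff expansion; the load-bearing content
of stub 3 (uniform-in-`L` survival of gapless order) is untouched; no crux and no summit statement is proved.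
Sources: W.-F. Tsai, S. A. Kivelson, PRB 73 (2006) 214510, App. A (A1) [TsaiKivelson2006]; T. Kato, *Perturbation
Theory for Linear Operators* (1966) II-§2.3. No definition and no named fact is introduced; sorry-free.
-/

noncomputable section

-- `dupNamespace`: the summit and the problem are both named `HubbardSuperconductivity` (layout D-0022)
set_option linter.dupNamespace false

namespace Summit.HubbardSuperconductivity.HubbardSuperconductivity.Theorems.AnisotropyChord.DressFirst

open Matrix Literature.MathematicalPhysics.QuantumLattice Literature.Probability.LatticeModels
open Literature.MathematicalPhysics.QuantumLattice.TorusPlaquette TwoCluster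
open Summit.HubbardSuperconductivity.HubbardSuperconductivity.Theorems.LevyLogBootstrap
open scoped ComplexOrder

variable {M : ℕ}

/-! ### One electron more or less is orthogonal to the plaquette ground states -/

/-- `⟨ψ_{κ'}, c†_i ψ_κ⟩ = 0`: the plaquette states carry `4 − 2κ ∈ {4, 2}` electrons, `c† ψ_κ` carries `5 − 2κ`.
[folklore] -/
theorem star_plaquetteStates_dotProduct_creation_mulVec (U : ℝ) (κ' κ : Fin 2) (i : Orb PlaquetteSite) :
    star (plaquetteStates U κ') ⬝ᵥ (creation i *ᵥ plaquetteStates U κ) = 0 := by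
  have hκ' := κ'.isLt
  have hκ := κ.isLt
  exact dotProduct_eq_zero_of_isNParticle_ne (by omega) (isNParticle_plaquetteStates U κ')
    (IsNParticle.creation_mulVec_holds (isNParticle_plaquetteStates U κ) i)

/-- `⟨ψ_{κ'}, c_i ψ_κ⟩ = 0`: `c ψ_κ` carries `3 − 2κ ∈ {3, 1}` electrons. [folklore] -/
theorem star_plaquetteStates_dotProduct_annihilation_mulVec (U : ℝ) (κ' κ : Fin 2) (i : Orb PlaquetteSite) :
    star (plaquetteStates U κ') ⬝ᵥ (annihilation i *ᵥ plaquetteStates U κ) = 0 := by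
  have hκ' := κ'.isLt
  have hκ := κ.isLt
  have hN : IsNParticle ((3 - 2 * (κ : ℕ)) + 1) (plaquetteStates U κ) := by
    have h := isNParticle_plaquetteStates U κ
    have e : 4 - 2 * (κ : ℕ) = (3 - 2 * (κ : ℕ)) + 1 := by omega
    rwa [e] at h
  exact dotProduct_eq_zero_of_isNParticle_ne (by omega) (isNParticle_plaquetteStates U κ')
    (IsNParticle.annihilation_mulVec_holds hN i)

/-! ### The first-order term vanishes on the dictionary -/

/-- A column of the dictionary is the slice, over any two distinct plaquettes, of its own two factors. [folklore] -/
theorem col_eq_sliceMap_mulVec_tensorVec (U : ℝ) (σ : TensorIndex (TorusSite 2 M) 2) {R R' : FermionTorus 2 M}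
    (h : R ≠ R') :
    (plaquettePartition M).prodFamily (plaqFamily U σ) =
      (plaquettePartition M).sliceMap (plaqFamily U σ) R R' *ᵥ
        tensorVec (plaqFamily U σ R) (plaqFamily U σ R') := by
  -- the `ClusterProduct` lemmas carry `LinearOrder.toDecidableEq` on the cluster index; `(_)` lets the instance unify
  rw [(plaquettePartition M).sliceMap_mulVec_tensorVec h, @Function.update_eq_self _ _ (_), @Function.update_eq_self _ _ (_)]

set_option linter.style.longLine false in
/-- **`⟨Φ e_{σ'}, T Φ e_σ⟩ = 0`** (`M ≥ 2`): the inter-plaquette hopping has no matrix elements between dictionary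
columns. `T col_σ = −Σ_{R,k} slice_{R,R+e_k}(ψ_σ)·(hop vectors)` (`hamiltonian_inter_mulVec_col`); pairing with
`col_{σ'} = slice_{R,R+e_k}(ψ_{σ'})(ψ_{σ'}(R) ⊗ ψ_{σ'}(R+e_k))` by the slice Gram identity leaves
`⟨ψ_{σ'}(R) ⊗ ψ_{σ'}(R+e_k), c†ψ ⊗ cψ⟩`-type factors, which vanish by particle number. Tsai–Kivelson (2006) App. A.
[folklore] -/
theorem star_col_dotProduct_hamiltonian_inter_mulVec_col [NeZero M] (hM : 2 ≤ M) (U : ℝ) (σ' σ : TensorIndex (TorusSite 2 M) 2) :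
    star ((plaquettePartition M).prodFamily (plaqFamily U σ')) ⬝ᵥ
      (hamiltonian (fermionTorusGraph 2 (2 * M) ⊓ SimpleGraph.comap
          (fun x : FermionTorus 2 (2 * M) => fun i : Fin 2 => ((ofLex x) i : ℕ) / 2) ⊤) 1 0 *ᵥ
        (plaquettePartition M).prodFamily (plaqFamily U σ)) = 0 := by
  rw [hamiltonian_inter_mulVec_col hM U σ, dotProduct_neg, neg_eq_zero, dotProduct_sum]
  refine Finset.sum_eq_zero fun R _ => ?_
  rw [dotProduct_sum]
  refine Finset.sum_eq_zero fun k _ => ?_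
  have hne : R ≠ plaqNbr R k := (plaqNbr_ne hM R k).symm
  rw [col_eq_sliceMap_mulVec_tensorVec U σ' hne,
    (plaquettePartition M).star_sliceMap_mulVec_dotProduct_sliceMap_mulVec hne]
  refine mul_eq_zero_of_right _ ?_
  rw [dotProduct_sum]
  refine Finset.sum_eq_zero fun q _ => ?_
  rw [dotProduct_sum]
  refine Finset.sum_eq_zero fun s _ => ?_
  rw [dotProduct_add, dotProduct_smul, dotProduct_smul, star_tensorVec_dotProduct_tensorVec,
    star_tensorVec_dotProduct_tensorVec]
  simp only [plaqFamily, star_plaquetteStates_dotProduct_creation_mulVec,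
    star_plaquetteStates_dotProduct_annihilation_mulVec, zero_mul, smul_zero, add_zero]

set_option linter.style.longLine false in
/-- **The first-order Schrieffer–Wolff term vanishes on the dictionary, sesquilinear form**: for all spin vectors
`φ', φ`, `⟨Φ φ', T Φ φ⟩ = 0` (`M ≥ 2`). [folklore] -/
theorem star_dictionaryMap_mulVec_dotProduct_hamiltonian_inter [NeZero M] (hM : 2 ≤ M) (U : ℝ)
    (φ' φ : TensorIndex (TorusSite 2 M) 2 → ℂ) :
    star (dictionaryMap M U *ᵥ φ') ⬝ᵥ
      (hamiltonian (fermionTorusGraph 2 (2 * M) ⊓ SimpleGraph.comap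
          (fun x : FermionTorus 2 (2 * M) => fun i : Fin 2 => ((ofLex x) i : ℕ) / 2) ⊤) 1 0 *ᵥ
        (dictionaryMap M U *ᵥ φ)) = 0 := by
  rw [dictionaryMap_mulVec, dictionaryMap_mulVec, star_sum, mulVec_sum, sum_dotProduct]
  refine Finset.sum_eq_zero fun σ' _ => ?_
  rw [dotProduct_sum]
  refine Finset.sum_eq_zero fun σ _ => ?_
  rw [mulVec_smul, star_smul, smul_dotProduct, dotProduct_smul,
    star_col_dotProduct_hamiltonian_inter_mulVec_col hM U σ' σ, smul_zero, smul_zero]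

set_option linter.style.longLine false in
/-- **`Φᴴ T Φ = 0`** — the dictionary compression of the inter-plaquette hopping vanishes identically (`M ≥ 2`): the
Schrieffer–Wolff expansion of `H_in + t' T` on the plaquette ground space starts at order `t'²` (Kato 1966 II-§2.3,
case `P T⁽¹⁾ P = 0`). [folklore] -/
theorem dictionaryMap_conjTranspose_mul_hamiltonian_inter_mul [NeZero M] (hM : 2 ≤ M) (U : ℝ) :
    (dictionaryMap M U)ᴴ *
        hamiltonian (fermionTorusGraph 2 (2 * M) ⊓ SimpleGraph.comap
          (fun x : FermionTorus 2 (2 * M) => fun i : Fin 2 => ((ofLex x) i : ℕ) / 2) ⊤) 1 0 *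
      dictionaryMap M U = 0 := by
  rw [ext_iff_mulVec]
  intro φ
  rw [zero_mulVec]
  -- a vector with vanishing inner products against every vector is zero
  have h : ∀ φ' : TensorIndex (TorusSite 2 M) 2 → ℂ,
      star φ' ⬝ᵥ (((dictionaryMap M U)ᴴ *
        hamiltonian (fermionTorusGraph 2 (2 * M) ⊓ SimpleGraph.comap
          (fun x : FermionTorus 2 (2 * M) => fun i : Fin 2 => ((ofLex x) i : ℕ) / 2) ⊤) 1 0 *
        dictionaryMap M U) *ᵥ φ) = 0 := by
    intro φ'
    rw [← mulVec_mulVec, ← mulVec_mulVec, dotProduct_mulVec, ← star_mulVec]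
    exact star_dictionaryMap_mulVec_dotProduct_hamiltonian_inter hM U φ' φ
  have h0 := h (((dictionaryMap M U)ᴴ *
        hamiltonian (fermionTorusGraph 2 (2 * M) ⊓ SimpleGraph.comap
          (fun x : FermionTorus 2 (2 * M) => fun i : Fin 2 => ((ofLex x) i : ℕ) / 2) ⊤) 1 0 *
        dictionaryMap M U) *ᵥ φ)
  exact dotProduct_star_self_eq_zero.1 h0

end Summit.HubbardSuperconductivity.HubbardSuperconductivity.Theorems.AnisotropyChord.DressFirst

end
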